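import Summits.BirchSwinnertonDyer.Rank1Residual.AdditivePotMult.PotMultBranchPAdicGrossZagierIffRouteG
import Summits.BirchSwinnertonDyer.Rank1Residual.AdditivePotMult.PotMultX3PartnerMinimal
import Summits.BirchSwinnertonDyer.Rank1Residual.AdditivePotMult.X3MBranchPAdicGrossZagier
import HarnessLib

/-!
# X3♯(M) (REDUCIBLE `E[p]`, potentially multiplicative) ∧ `r_an = 1`, EVERY odd `p` (`p = 3` included):
# the Route-G CAPSTONE `BSD(E,p) ⟺ ∀ (B)-data, typed (M) p-adic Gross–Zagier` on the index-`n₀` rows,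
# and its rider (Schneider for every (B)-datum from the one-sided bit `c₁ ≠ 0`) — the X3♯(M) twin of
# n1011-p07's T-E3gM `PotMultBranchPAdicGrossZagierIffRouteG.lean` (cell `b2b-bsdres`, team n1011, seat
# p12 (gen 2); lead GEN 6 R5-31: "X3♯(M) twins of 1b/2/2b/3/2c are yours"; this is 2c)

HONEST FRAMING (cell `b2b-bsdres`, run/shared/lean/b2b/bsd-rank1-residual/, verbatim in every
file): the goal of the cell is to DELETE the COMBINATION-SHAPED residual classes of the
Birch–Swinnerton-Dyer formula for ALL analytic-rank `≤ 1` elliptic curves over `ℚ` — "full BSD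
formula for every rank `≤ 1` curve in class `C`" assembled STRICTLY from published theorems — so
that the rank-`≤ 1` remainder becomes exactly the CONSTRUCTION-SHAPED classes, which are TYPED
(missing-input `Prop`s), NOT attempted. This is not "finishing BSD". Team n1011 (RESIDUAL-MAP §I
O7-ord, X3♯(M) share: X3 ∧ pot-mult(p) ∧ `r_an = 1`, every odd `p`): research route on the
CONSTRUCTION-SHAPED class O7; labels and marks UNCHANGED; nothing booked; NO Literature fact minted;
no definition. THEOREMS ONLY; named facts enter as HYPOTHESES (`hW16` = Wuthrich 2014 Thm. 16,
half-eigen divisibility with REDUCIBLE `E[p]`, `Wuthrich2014.thm16_halfEigenCharIdeal_dvd_cyclotomicPrime`;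
`hDelM` = `Delbourgo2002.mainTheorem_potMult`; GZK `hGZK`; modularity `hmod`, `hmodD`). OUR conjecture as
the conclusion's right-hand side: n1011-p01's typed (M) `p`-adic Gross–Zagier `BranchPAdicGrossZagierMultAt`
(OPEN in rank one). EVIDENCE-tier / typed per-pair inputs: census-ctyper1's record
`Mult[Odd]FirstUnitIndexAt W p n₀`, n1011-p10's budget `BudgetLeLambdaAt p W n₀`, the one-sided bit
`c₁ ≠ 0`. No `_holds`; debt 0.

## What this file proves (p07's 2c proofs verbatim with (hK ∧ Surj ∧ tower) ↦ hW16 ∧ reducibility)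

* §1 RIDER `ClassX3M.forall_schneider_of_wuthrichHalf_of_multCoeffOneNeZero`: X3♯(M) ∧ `r_an = 1`,
  `hW16` + the bit `c₁ ≠ 0` on every multiplicative twist datum ⟹ for EVERY (B)-datum `Dh`:
  Schneider's `Reg_p(E,Dh) ≠ 0` and `#Ш(E)[p^∞] < ∞` (this seat's brick
  `isTorsion_and_exists_iota_eq_of_wuthrichHalf` + additive-p2's cell-agnostic
  `schneider_and_padicVal_le_rankOne_of_iota_eq`; NO `λ ≤ 1`: valid on index-`n₀ ≥ 3` rows).
* §2 CAPSTONE `ClassX3M.bsdp_iff_forall_branchPAdicGrossZagierMultAt_of_wuthrichHalf_of_firstUnitIndex_of_budget`: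
  record at `n₀` + budget + bit ⟹ **`BSD(E,p) ⟺ ∀ Dh, LeadingTermClauses W p Dh → BranchPAdicGrossZagierMultAt W p Dh`**
  — n1011-p01's X3♯(M) socket `ClassX3M.bsdp_iff_forall_branchPAdicGrossZagierMultAt_of_quadraticBranchLower_of_wuthrichHalf`
  (`X3MBranchPAdicGrossZagier.lean`) with `hc` := this seat's K-OUT
  `ClassX3M.forall_quadraticBranchLowerDivisibilityAt_of_wuthrichHalf_of_firstUnitIndex_of_budget'` and
  `hSall` := §1; `…three…` (`p = 3`); `…_of_firstUnitIndex_one` (index `1` = T-O7KM-X3's certified rows: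
  NO budget, NO separate bit — the IMC-version ∀-datum companion of this seat's per-datum CERT iff
  `PotMultX3BranchPAdicGrossZagierCertIff.lean`).

OUTPUT = `BSDp ⟺ typed p-adic GZ`, NOT `BSD_p`; O7-ord UNCHANGED. NOT binders: `Surj`, tower, `5 ≤ p`,
`¬CM`, `hna`, `hL20`, `hPal`. Labels UNCHANGED; nothing booked; X3 stays CONSTRUCTION-SHAPED.

BUDGET SOURCE ON X3 ROWS (n1011-r2 GEN 7, ROUTE-2 II.13.2): n1011-p10's typed input `BudgetLeLambdaAt p W b`
is a THEOREM for `b ≤ rank E(ℚ)` (p07's `budgetLeLambdaAt_of_le_mordellWeilRank`; the index-`1` form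
below); for `b > rank E(ℚ)` its printed discharge (Emerton–Pollack–Weston 2006) assumes `ρ̄` ABSOLUTELY
IRREDUCIBLE, so on X3 rows the budget is an UNPRINTED per-pair binder (candidate discharge: Greenberg
LNM 1716 Prop. 4.14 + Greenberg 2010 Prop. 3.2.1 (b) + II.10.9, to be instantiated — T-E3gX3-bud).

References: C. Wuthrich, Doc. Math. 19 (2014) Thm. 16, §3 [Wuthrich2014]; D. Delbourgo, J. Number Theory
95 (2002) Thm. (A), (B) [Delbourgo2002]; P. Schneider, Invent. Math. 79 (1985) Thm. 2′ (shape)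
[Schneider1985]; R. Greenberg, LNM 1716 (1999) §3 Lemma 3.1 [GreenbergLNM1716]; M. Emerton, R. Pollack,
T. Weston, Invent. Math. 163 (2006) §3 (source of the typed budget on irreducible rows only)
[EmertonPollackWeston2006]; B. Mazur, J. Tate, J. Teitelbaum, Invent. Math. 84 (1986) §I.13
[MazurTateTeitelbaum1986Invent]; R. L. Miller, LMS J. Comput. Math. 14 (2011) Def. 1.1 [Miller2011LMS].
-/

set_option autoImplicit false

noncomputable section

open scoped Classical MatrixGroups ModularForm NumberField

namespace Summit.BirchSwinnertonDyer.Rank1Residual.AdditivePotMult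

open CongruenceSubgroup WeierstrassCurve NumberField Literature.NumberTheory.EllipticCurves
  Literature.NumberTheory.EllipticCurves.ModularForms
  Literature.NumberTheory.EllipticCurves.Rank1Residual
  Literature.NumberTheory.EllipticCurves.Rank1Residual.Typed
  Literature.NumberTheory.EllipticCurves.Delbourgo2002
  Literature.NumberTheory.GaloisRepresentations
  Summit.BirchSwinnertonDyer.Rank1Residual.Additive
  Summit.BirchSwinnertonDyer.Rank1Residual.Additive.CensusQ6
  IsDedekindDomain

/-! ### §1 The rider on X3♯(M) rows: Schneider for every (B)-datum from the one-sided bit `c₁ ≠ 0` -/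

section Rider

variable {W : WeierstrassCurve ℚ} [W.IsElliptic] [W.IsGloballyMinimal] {p : ℕ} [hp : Fact p.Prime]

/-- **THE RIDER on X3♯(M) ∧ `r_an = 1`, EVERY odd `p` (`p = 3` included): Schneider's `Reg_p(E,Dh) ≠ 0`
and `#Ш(E)[p^∞] < ∞` for EVERY (B)-datum `Dh`, from Wuthrich's divisibility and the ONE-SIDED bit
`c₁ ≠ 0`** on every multiplicative twist datum (`hne`, census-literal binder; implied by
`MultBranchUnitCertificateAt W p` and by any record at index `1`). Route: the multiplicative twist model,
`E♭[p]` reducible (`irr_iff_of_model_twist`), the modular parametrisation, the brick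
`isTorsion_and_exists_iota_eq_of_wuthrichHalf` (`g ∈ char_Λ X(E/ℚ_∞)`, `ι g = C(u·ϖ)·B`; NO tower),
`rank E(ℚ) = 1` (GZK), additive-p2's `schneider_and_padicVal_le_rankOne_of_iota_eq`. No `λ ≤ 1`.
[cite: Wuthrich2014, Thm. 16 (p. 397)] [cite: Delbourgo2002, Theorem (B) (p. 40)]
[cite: Schneider1985, Thm. 2′ (shape; nothing asserted)] -/
theorem ClassX3M.forall_schneider_of_wuthrichHalf_of_multCoeffOneNeZero
    (hW16 : Wuthrich2014.thm16_halfEigenCharIdeal_dvd_cyclotomicPrime)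
    (hmodD : nonempty_modularParametrizationData)
    (hGZK : rank_eq_analyticRank_of_analyticRank_le_one)
    (hX : ClassX3M W p) (hr : W.analyticRank = 1)
    (hne : ∀ (V : WeierstrassCurve ℚ) [V.IsElliptic] [V.IsGloballyMinimal] (C : VariableChange ℚ),
      Mult V p → C • V.quadraticTwist ((-1 : ℚ) ^ (p / 2) * p) = W →
      ∀ {N : ℕ} [NeZero N] (f : CuspForm (Gamma0 N) 2), IsNewformOf V f → ∀ (ap : ℤ), cuspCoeff f p = ap →
      ∀ ϖ : ℚ, (if Even (p / 2) then (ϖ : ℝ) * V.realPeriodRat = plusPeriod f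
          else (ϖ : ℝ) * V.imaginaryPeriodRat = minusPeriod f) →
        PowerSeries.coeff 1 (PowerSeries.C (ϖ : ℚ_[p]) *
            (if Even (p / 2) then padicLFunctionPlusBranchMult f (ap : ℚ_[p]) (p / 2)
              else padicLFunctionMinusBranchMult f (ap : ℚ_[p]) (p / 2))) ≠ 0)
    {Dh : PAdicHeightData W p} (hB : LeadingTermClauses W p Dh) :
    SchneiderConjecture Dh ∧ Finite (AddCommGroup.primaryComponent W.sha p) := by
  obtain ⟨hmw, -⟩ := hGZK W (by rw [hr])
  have hr1 : W.mordellWeilRank = 1 := by rw [hmw, hr]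
  have hp2 : p ≠ 2 := hX.p_ne_two
  obtain ⟨V, iV, iVm, C, hV, hC⟩ := hX.exists_mult_pStar_twist_model
  haveI : NeZero (V.conductorNorm ℤ) := ⟨(V.conductorNorm_pos_holds).ne'⟩
  obtain ⟨Dm⟩ := hmodD V
  obtain ⟨ϖ, hϖ⟩ := exists_periodRatio_parity (p := p) V Dm
  have hirrV : ¬ V.HasIrreducibleModPGaloisRep p := fun hVirr ↦
    hX.classX3.1 ((irr_iff_of_model_twist (W := V) (p := p) (pStar_ne_zero p) ⟨C, hC⟩).mpr hVirr)
  obtain ⟨κ, hκ, γ, hγ, hγ'⟩ := exists_isCyclotomic_isTopGenerator_isCyclotomicVariable_holds p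
  obtain ⟨D⟩ := W.nonempty_selmerDualData_holds κ γ hγ
  haveI : Module.Finite (IwasawaAlgebra p) D.X := D.module_finite_holds hγ
  obtain ⟨fE, hchar, -⟩ := exists_charIdeal_eq_span_singleton p D
  by_cases hs : V.HasSplitMultiplicativeReductionAtPrime p
  · obtain ⟨hap, -⟩ := Dm.isNewformOf.cuspCoeff_eq_one_and_sq_of_split hs
    obtain ⟨hXt, g, hg, u, hι⟩ := isTorsion_and_exists_iota_eq_of_wuthrichHalf hW16 hp2 V C hC hirrV hκ
      hγ hγ' Dm.isNewformOf D _ (Or.inr (Or.inl ⟨hs, rfl⟩)) ϖ hϖ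
    have h1 := hne V C hV hC Dm.f Dm.isNewformOf 1 (by exact_mod_cast hap) ϖ hϖ
    rw [Int.cast_one] at h1
    obtain ⟨hS, hfin, -⟩ :=
      schneider_and_padicVal_le_rankOne_of_iota_eq hp2 hr1 hB hκ hγ hγ' D hXt hchar hg hι h1
    exact ⟨hS, hfin⟩
  · obtain ⟨hap, -⟩ := Dm.isNewformOf.cuspCoeff_eq_neg_one_and_dvd_of_nonsplit hV hs
    obtain ⟨hXt, g, hg, u, hι⟩ := isTorsion_and_exists_iota_eq_of_wuthrichHalf hW16 hp2 V C hC hirrV hκ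
      hγ hγ' Dm.isNewformOf D _ (Or.inr (Or.inr ⟨hV, hs, rfl⟩)) ϖ hϖ
    have h1 := hne V C hV hC Dm.f Dm.isNewformOf (-1) (by exact_mod_cast hap) ϖ hϖ
    rw [Int.cast_neg, Int.cast_one] at h1
    obtain ⟨hS, hfin, -⟩ :=
      schneider_and_padicVal_le_rankOne_of_iota_eq hp2 hr1 hB hκ hγ hγ' D hXt hchar hg hι h1
    exact ⟨hS, hfin⟩

end Rider

/-! ### §2 The CAPSTONE on X3♯(M): `BSDp ⟺ ∀ (B)-data, typed p-adic GZ` on the index-`n₀` rows -/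

section Capstone

variable {W : WeierstrassCurve ℚ} [W.IsElliptic] [W.IsGloballyMinimal] {p : ℕ} [hp : Fact p.Prime]

/-- **CAPSTONE, X3♯(M) ∧ `r_an = 1`, EVERY odd `p` (`p = 3` included):** given Wuthrich's Thm. 16 `hW16`,
Delbourgo 2002 (M) `hDelM`, GZK, modularity, the census record at index `n₀` (parity of `(p−1)/2`;
CERTIFICATE-EVIDENCE), n1011-p10's budget `BudgetLeLambdaAt p W n₀` (typed per curve; a theorem when
`n₀ ≤ rank`; or from a congruent partner, `PotMultX3PartnerMinimal.lean` §2) and the one-sided bit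
`c₁ ≠ 0` (`hne`): **`BSD(E,p) ⟺ ∀ Dh, LeadingTermClauses W p Dh → BranchPAdicGrossZagierMultAt W p Dh`**
— the row is REDUCED to the typed `p`-adic Gross–Zagier formula at the additive prime (O7-ord,
CONSTRUCTION-SHAPED, UNCHANGED). n1011-p01's X3♯(M) iff with `hc` := this seat's K-OUT and `hSall` := §1.
NO image hypothesis anywhere. [cite: Wuthrich2014, Thm. 16 (p. 397)] [cite: Delbourgo2002, Theorem (A), (B) (p. 40)]
[cite: Miller2011LMS, Def. 1.1] -/
theorem ClassX3M.bsdp_iff_forall_branchPAdicGrossZagierMultAt_of_wuthrichHalf_of_firstUnitIndex_of_budget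
    (hDelM : Delbourgo2002.mainTheorem_potMult)
    (hW16 : Wuthrich2014.thm16_halfEigenCharIdeal_dvd_cyclotomicPrime)
    (hmod : hasEntireLFunction_rat) (hmodD : nonempty_modularParametrizationData)
    (hGZK : rank_eq_analyticRank_of_analyticRank_le_one)
    (hX : ClassX3M W p) (hr : W.analyticRank = 1) {n₀ : ℕ}
    (hrec : (p % 4 = 1 → MultFirstUnitIndexAt W p n₀) ∧ (p % 4 = 3 → MultOddFirstUnitIndexAt W p n₀))
    (hbud : BudgetLeLambdaAt p W n₀)
    (hne : ∀ (V : WeierstrassCurve ℚ) [V.IsElliptic] [V.IsGloballyMinimal] (C : VariableChange ℚ),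
      Mult V p → C • V.quadraticTwist ((-1 : ℚ) ^ (p / 2) * p) = W →
      ∀ {N : ℕ} [NeZero N] (f : CuspForm (Gamma0 N) 2), IsNewformOf V f → ∀ (ap : ℤ), cuspCoeff f p = ap →
      ∀ ϖ : ℚ, (if Even (p / 2) then (ϖ : ℝ) * V.realPeriodRat = plusPeriod f
          else (ϖ : ℝ) * V.imaginaryPeriodRat = minusPeriod f) →
        PowerSeries.coeff 1 (PowerSeries.C (ϖ : ℚ_[p]) *
            (if Even (p / 2) then padicLFunctionPlusBranchMult f (ap : ℚ_[p]) (p / 2)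
              else padicLFunctionMinusBranchMult f (ap : ℚ_[p]) (p / 2))) ≠ 0) :
    BSDp W p ↔
      ∀ Dh : PAdicHeightData W p, LeadingTermClauses W p Dh → BranchPAdicGrossZagierMultAt W p Dh :=
  hX.bsdp_iff_forall_branchPAdicGrossZagierMultAt_of_quadraticBranchLower_of_wuthrichHalf hDelM hW16 hmod
    hmodD hGZK hr
    (fun V _ _ hVW ↦
      hX.forall_quadraticBranchLowerDivisibilityAt_of_wuthrichHalf_of_firstUnitIndex_of_budget' hW16 hrec
        hbud V hVW)
    (fun _ hB ↦ (hX.forall_schneider_of_wuthrichHalf_of_multCoeffOneNeZero hW16 hmodD hGZK hr hne hB).1)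

/-- **`p = 3` specialisation** (the X3♯(M) `r_an = 1` rows at `3`): record `MultOddFirstUnitIndexAt W 3 n₀`
+ budget + bit ⟹ `BSD(E,3) ⟺ ∀ Dh, LeadingTermClauses W 3 Dh → BranchPAdicGrossZagierMultAt W 3 Dh`.
[cite: Wuthrich2014, Thm. 16 (p. 397)] [cite: Delbourgo2002, Theorem (A), (B) (p. 40)] -/
theorem ClassX3M.bsdp_three_iff_forall_branchPAdicGrossZagierMultAt_of_wuthrichHalf_of_firstUnitIndex_of_budget
    [Fact (Nat.Prime 3)] {W : WeierstrassCurve ℚ} [W.IsElliptic] [W.IsGloballyMinimal]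
    (hDelM : Delbourgo2002.mainTheorem_potMult)
    (hW16 : Wuthrich2014.thm16_halfEigenCharIdeal_dvd_cyclotomicPrime)
    (hmod : hasEntireLFunction_rat) (hmodD : nonempty_modularParametrizationData)
    (hGZK : rank_eq_analyticRank_of_analyticRank_le_one)
    (hX : ClassX3M W 3) (hr : W.analyticRank = 1) {n₀ : ℕ}
    (hrec : MultOddFirstUnitIndexAt W 3 n₀) (hbud : BudgetLeLambdaAt 3 W n₀)
    (hne : ∀ (V : WeierstrassCurve ℚ) [V.IsElliptic] [V.IsGloballyMinimal] (C : VariableChange ℚ),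
      Mult V 3 → C • V.quadraticTwist ((-1 : ℚ) ^ (3 / 2) * (3 : ℕ)) = W →
      ∀ {N : ℕ} [NeZero N] (f : CuspForm (Gamma0 N) 2), IsNewformOf V f → ∀ (ap : ℤ), cuspCoeff f 3 = ap →
      ∀ ϖ : ℚ, (if Even (3 / 2) then (ϖ : ℝ) * V.realPeriodRat = plusPeriod f
          else (ϖ : ℝ) * V.imaginaryPeriodRat = minusPeriod f) →
        PowerSeries.coeff 1 (PowerSeries.C (ϖ : ℚ_[3]) *
            (if Even (3 / 2) then padicLFunctionPlusBranchMult f (ap : ℚ_[3]) (3 / 2)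
              else padicLFunctionMinusBranchMult f (ap : ℚ_[3]) (3 / 2))) ≠ 0) :
    BSDp W 3 ↔
      ∀ Dh : PAdicHeightData W 3, LeadingTermClauses W 3 Dh → BranchPAdicGrossZagierMultAt W 3 Dh :=
  hX.bsdp_iff_forall_branchPAdicGrossZagierMultAt_of_wuthrichHalf_of_firstUnitIndex_of_budget hDelM hW16
    hmod hmodD hGZK hr ⟨fun h ↦ absurd h (by norm_num), fun _ ↦ hrec⟩ hbud hne

/-- **Index `1` (T-O7KM-X3's certified rows): NO budget and NO separate bit.** X3♯(M) ∧ `r_an = 1`, EVERY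
odd `p`, record at index `1` ⟹ `BSD(E,p) ⟺ ∀ Dh, LeadingTermClauses W p Dh → BranchPAdicGrossZagierMultAt W p Dh`
— `n₀ = 1 = rank E(ℚ)` (GZK) makes the budget a theorem (p07's `budgetLeLambdaAt_of_le_mordellWeilRank`)
and the record's unit at index `1` IS the bit (p07's `coeff_multBranch_ne_zero_of_firstUnitIndex`). The
IMC-version (∀-datum) companion of this seat's per-datum CERT-literal iff
(`PotMultX3BranchPAdicGrossZagierCertIff.lean`) on the same rows; nothing new is covered.
[cite: Wuthrich2014, Thm. 16 (p. 397)] [cite: Delbourgo2002, Theorem (A), (B) (p. 40)]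
[cite: GreenbergLNM1716, §3 Lemma 3.1 (T^{rank} ∣ char)] -/
theorem ClassX3M.bsdp_iff_forall_branchPAdicGrossZagierMultAt_of_wuthrichHalf_of_firstUnitIndex_one
    (hDelM : Delbourgo2002.mainTheorem_potMult)
    (hW16 : Wuthrich2014.thm16_halfEigenCharIdeal_dvd_cyclotomicPrime)
    (hmod : hasEntireLFunction_rat) (hmodD : nonempty_modularParametrizationData)
    (hGZK : rank_eq_analyticRank_of_analyticRank_le_one)
    (hX : ClassX3M W p) (hr : W.analyticRank = 1)
    (hrec : (p % 4 = 1 → MultFirstUnitIndexAt W p 1) ∧ (p % 4 = 3 → MultOddFirstUnitIndexAt W p 1)) :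
    BSDp W p ↔
      ∀ Dh : PAdicHeightData W p, LeadingTermClauses W p Dh → BranchPAdicGrossZagierMultAt W p Dh :=
  hX.bsdp_iff_forall_branchPAdicGrossZagierMultAt_of_wuthrichHalf_of_firstUnitIndex_of_budget hDelM hW16
    hmod hmodD hGZK hr hrec
    (budgetLeLambdaAt_of_le_mordellWeilRank (by rw [(hGZK W (by rw [hr])).1, hr]))
    (fun V _ _ C hV hC _ _ f hf ap hap ϖ hϖ ↦
      coeff_multBranch_ne_zero_of_firstUnitIndex hX.p_ne_two hrec V C hV hC f hf ap hap ϖ hϖ)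

end Capstone

end Summit.BirchSwinnertonDyer.Rank1Residual.AdditivePotMult

end
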